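import Summits.HubbardSuperconductivity.HubbardSuperconductivity.Theorems.AnisotropyChordFourTorusClasses

/-!
# Route `AnisotropyChord` / crux `FerroSideChord` at `M = 4`: SEMANTICS OF THE PACKED REDUCED TABLES
(prover seat `hubbard-h0-rotor-p1` g17)

* `children_lt`, `ordPairs_lt` — the reduced data only mention classes `< 58`;
* `cnt_eq_count` — `cnt ρ r = (children ρ).count r`; `pqm_eq_countPair` — `pqm ρ p q = countPair p q (ordPairs ρ)`
  (packing lemma `field_extract` applied to the table constructions `cntTab`, `pqTab`);
* `list_sum_map_eq_count`, `list_sum_map_eq_countPair` — list sums regrouped by value.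
-/

set_option linter.style.longLine false
set_option linter.dupNamespace false
set_option autoImplicit false

open Finset

namespace Summit.HubbardSuperconductivity.HubbardSuperconductivity.Theorems.AnisotropyChord.FourTorus

/-! ## Bounds on the reduced data -/

/-- children classes are `< 58`. [folklore] -/
theorem children_lt {ρ : ℕ} (hρ : ρ < 56) : ∀ c ∈ children ρ, c < 58 := by
  intro c hc
  unfold children at hc
  rw [List.mem_filterMap] at hc
  obtain ⟨i, hi, hci⟩ := hc
  rw [List.mem_range] at hi
  cases hb : Nat.testBit (rep9 ρ) i with
  | false => rw [hb] at hci; exact absurd hci (by simp)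
  | true =>
    rw [hb, cond_true, Option.some.injEq] at hci
    obtain ⟨hp, hlt⟩ := (rep9_facts hρ).2.2.2 i hi hb
    rw [← hci]; exact (check8_facts hlt hp).1

/-- `children ρ` has at most 16 entries. [folklore] -/
theorem children_length_le (ρ : ℕ) : (children ρ).length ≤ 16 := by
  unfold children
  exact le_trans (List.length_filterMap_le _ _) (by simp)

/-- ordered-pair classes are `< 58`. [folklore] -/
theorem ordPairs_lt {ρ : ℕ} (hρ : ρ < 56) : ∀ pq ∈ ordPairs ρ, pq.1 < 58 ∧ pq.2 < 58 := by
  intro pq hpq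
  unfold ordPairs at hpq
  rw [List.mem_flatMap] at hpq
  obtain ⟨i, hi, hmem⟩ := hpq
  rw [List.mem_filterMap] at hmem
  obtain ⟨j, hj, hij⟩ := hmem
  rw [List.mem_range] at hi hj
  cases hb : (adj16 i j && Nat.testBit (rep9 ρ) i && Nat.testBit (rep9 ρ) j) with
  | false => rw [hb] at hij; exact absurd hij (by simp)
  | true =>
    rw [hb, cond_true, Option.some.injEq] at hij
    simp only [Bool.and_eq_true] at hb
    obtain ⟨⟨-, hbi⟩, hbj⟩ := hb
    obtain ⟨hpi, hlti⟩ := (rep9_facts hρ).2.2.2 i hi hbi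
    obtain ⟨hpj, hltj⟩ := (rep9_facts hρ).2.2.2 j hj hbj
    rw [← hij]
    exact ⟨(check8_facts hlti hpi).1, (check8_facts hltj hpj).1⟩

/-- `ordPairs ρ` has at most `256` entries. [folklore] -/
theorem ordPairs_length_le (ρ : ℕ) : (ordPairs ρ).length ≤ 256 := by
  unfold ordPairs
  rw [List.length_flatMap]
  have h : ∀ i ∈ List.range 16, ((List.range 16).filterMap fun j =>
      bif adj16 i j && Nat.testBit (rep9 ρ) i && Nat.testBit (rep9 ρ) j then
        some (cls (rep9 ρ ^^^ 2 ^ i), cls (rep9 ρ ^^^ 2 ^ j)) else none).length ≤ 16 :=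
    fun i _ => le_trans (List.length_filterMap_le _ _) (by simp)
  calc ((List.range 16).map fun i => ((List.range 16).filterMap fun j =>
          bif adj16 i j && Nat.testBit (rep9 ρ) i && Nat.testBit (rep9 ρ) j then
            some (cls (rep9 ρ ^^^ 2 ^ i), cls (rep9 ρ ^^^ 2 ^ j)) else none).length).sum
      ≤ ((List.range 16).map fun _ => 16).sum := List.sum_le_sum h
    _ = 256 := by simp

/-! ## List sums regrouped by value -/

/-- `Σ_{c ∈ l} v c = Σ_{r<R} count_r · v r` for a list of naturals `< R`. [folklore] -/
theorem list_sum_map_eq_count {β : Type} [CommSemiring β] (R : ℕ) (v : ℕ → β) (l : List ℕ) (hl : ∀ x ∈ l, x < R) :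
    (l.map v).sum = ∑ r ∈ range R, (l.count r : β) * v r := by
  induction l with
  | nil => simp
  | cons x l ih =>
    rw [List.map_cons, List.sum_cons, ih (fun y hy => hl y (List.mem_cons_of_mem _ hy))]
    have hx : x < R := hl x (by simp)
    rw [show v x = ∑ r ∈ range R, (if r = x then 1 else 0) * v r by
      simp_rw [ite_mul, one_mul, zero_mul]; rw [Finset.sum_ite_eq']; simp [hx]]
    rw [← Finset.sum_add_distrib]
    refine Finset.sum_congr rfl fun r _ => ?_
    rw [List.count_cons]
    by_cases h : r = x
    · subst h; simp; ring
    · have : (x == r) = false := by simpa [beq_iff_eq] using fun h' => h h'.symm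
      simp [h, this]

/-- `Σ_{(p,q) ∈ l} F p q = Σ_{p<R} Σ_{q<R} countPair_{pq} · F p q` for pairs `< R`. [folklore] -/
theorem list_sum_map_eq_countPair {β : Type} [CommSemiring β] (R : ℕ) (F : ℕ → ℕ → β) (l : List (ℕ × ℕ)) (hl : ∀ x ∈ l, x.1 < R ∧ x.2 < R) :
    (l.map fun x => F x.1 x.2).sum = ∑ p ∈ range R, ∑ q ∈ range R, (countPair p q l : β) * F p q := by
  induction l with
  | nil => simp [countPair]
  | cons x l ih =>
    rw [List.map_cons, List.sum_cons, ih (fun y hy => hl y (List.mem_cons_of_mem _ hy))]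
    obtain ⟨h1, h2⟩ := hl x (by simp)
    have hF : F x.1 x.2 = ∑ p ∈ range R, ∑ q ∈ range R, (if p = x.1 ∧ q = x.2 then 1 else 0) * F p q := by
      rw [Finset.sum_eq_single_of_mem x.1 (mem_range.2 h1) (fun p _ hp => by
        rw [Finset.sum_eq_zero]; intro q _; rw [if_neg (fun h => hp h.1)]; ring)]
      rw [Finset.sum_eq_single_of_mem x.2 (mem_range.2 h2) (fun q _ hq => by rw [if_neg (fun h => hq h.2)]; ring)]
      simp
    rw [hF, ← Finset.sum_add_distrib]
    refine Finset.sum_congr rfl fun p _ => ?_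
    rw [← Finset.sum_add_distrib]
    refine Finset.sum_congr rfl fun q _ => ?_
    unfold countPair
    rw [List.countP_cons]
    by_cases h : p = x.1 ∧ q = x.2
    · rw [if_pos h]
      have : (x.1 == p && x.2 == q) = true := by simp [h.1.symm, h.2.symm]
      rw [this]; simp; ring
    · rw [if_neg h]
      have : (x.1 == p && x.2 == q) = false := by
        simpa [Bool.and_eq_true, beq_iff_eq, not_and_or] using fun h1 h2 => h ⟨h1.symm, h2.symm⟩
      rw [this]; simp

/-! ## The packed tables -/

/-- `countIn r l = l.count r`. [folklore] -/
theorem countIn_eq_count (r : ℕ) (l : List ℕ) : countIn r l = l.count r := by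
  unfold countIn; rfl

/-- the child-count table as a power sum over the block index `58 ρ + r`. [folklore] -/
theorem cntTab_eq : cntTab = ∑ idx ∈ range (56 * 58), (children (idx / 58)).count (idx % 58) * 2 ^ (5 * idx) := by
  unfold cntTab
  have step : (fun (ρ : ℕ) (acc : ℕ) => (children ρ).foldl (fun a c => a + 2 ^ (5 * (58 * ρ + c))) acc)
      = fun ρ acc => acc + ((children ρ).map fun c => 2 ^ (5 * (58 * ρ + c))).sum := by
    funext ρ acc; rw [foldl_pow_eq]
  rw [step, iter_add_eq, zero_add, ← sum_blocks]
  refine Finset.sum_congr rfl fun ρ hρ => ?_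
  have hρ' := mem_range.1 hρ
  have hmul : ∀ c, (2 : ℕ) ^ (5 * (58 * ρ + c)) = 2 ^ (5 * c) * 2 ^ (5 * (58 * ρ)) := by
    intro c; rw [← pow_add]; congr 1; ring
  simp_rw [hmul]
  rw [List.sum_map_mul_right, sum_pow_eq_count 5 58 (children ρ) (children_lt hρ'), Finset.sum_mul]
  refine Finset.sum_congr rfl fun r hr => ?_
  have hr' := mem_range.1 hr
  rw [show (58 * ρ + r) / 58 = ρ by omega, show (58 * ρ + r) % 58 = r by omega]
  ring

/-- **`cnt ρ r` is the multiplicity of `r` among the children of `rep9 ρ`.** [folklore] -/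
theorem cnt_eq_count {ρ r : ℕ} (hρ : ρ < 56) (hr : r < 58) : cnt ρ r = (children ρ).count r := by
  unfold cnt
  rw [cntTab_eq]
  have hb : ∀ idx, (children (idx / 58)).count (idx % 58) < 2 ^ 5 :=
    fun idx => lt_of_le_of_lt (List.count_le_length) (lt_of_le_of_lt (children_length_le _) (by norm_num))
  rw [field_extract 5 (fun idx => (children (idx / 58)).count (idx % 58)) hb (56 * 58) (58 * ρ + r) (by omega)]
  show (children ((58 * ρ + r) / 58)).count ((58 * ρ + r) % 58) = (children ρ).count r
  rw [show (58 * ρ + r) / 58 = ρ by omega, show (58 * ρ + r) % 58 = r by omega]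

/-- the pair table as a power sum over the block index `3364 ρ + 58 p + q`. [folklore] -/
theorem pqTab_eq : pqTab = ∑ idx ∈ range (56 * 3364),
    countPair ((idx % 3364) / 58) (idx % 58) (ordPairs (idx / 3364)) * 2 ^ (9 * idx) := by
  unfold pqTab
  have step : (fun (ρ : ℕ) (acc : ℕ) => (ordPairs ρ).foldl (fun a pq => a + 2 ^ (9 * (3364 * ρ + (58 * pq.1 + pq.2)))) acc)
      = fun ρ acc => acc + ((ordPairs ρ).map fun pq => 2 ^ (9 * (3364 * ρ + (58 * pq.1 + pq.2)))).sum := by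
    funext ρ acc; rw [foldl_pow_eq]
  rw [step, iter_add_eq, zero_add, ← sum_blocks]
  refine Finset.sum_congr rfl fun ρ hρ => ?_
  have hρ' := mem_range.1 hρ
  -- inner: the 58 × 58 block
  have hmul : ∀ pq : ℕ × ℕ, (2 : ℕ) ^ (9 * (3364 * ρ + (58 * pq.1 + pq.2))) = 2 ^ (9 * (58 * pq.1 + pq.2)) * 2 ^ (9 * (3364 * ρ)) := by
    intro pq; rw [← pow_add]; congr 1; ring
  simp_rw [hmul]
  rw [List.sum_map_mul_right]
  have hreg : ((ordPairs ρ).map fun pq : ℕ × ℕ => ((2 : ℕ) ^ (9 * (58 * pq.1 + pq.2)) : ℕ)).sum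
      = ∑ p ∈ range 58, ∑ q ∈ range 58, countPair p q (ordPairs ρ) * 2 ^ (9 * (58 * p + q)) := by
    have h := list_sum_map_eq_countPair (β := ℕ) 58 (fun p q => (2 : ℕ) ^ (9 * (58 * p + q))) (ordPairs ρ) (ordPairs_lt hρ')
    simpa using h
  rw [hreg, Finset.sum_mul, show (3364 : ℕ) = 58 * 58 by norm_num, ← sum_blocks 58 58]
  refine Finset.sum_congr rfl fun p hp => ?_
  rw [Finset.sum_mul]
  refine Finset.sum_congr rfl fun q hq => ?_
  have hp' := mem_range.1 hp; have hq' := mem_range.1 hq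
  rw [show (58 * 58 * ρ + (58 * p + q)) % (58 * 58) / 58 = p by omega, show (58 * 58 * ρ + (58 * p + q)) % 58 = q by omega,
    show (58 * 58 * ρ + (58 * p + q)) / (58 * 58) = ρ by omega]
  ring

/-- **`pqm ρ p q` is the multiplicity of `(p, q)` among the ordered pairs of `rep9 ρ`.** [folklore] -/
theorem pqm_eq_countPair {ρ p q : ℕ} (hρ : ρ < 56) (hp : p < 58) (hq : q < 58) : pqm ρ p q = countPair p q (ordPairs ρ) := by
  unfold pqm
  rw [pqTab_eq]
  have hb : ∀ idx, countPair ((idx % 3364) / 58) (idx % 58) (ordPairs (idx / 3364)) < 2 ^ 9 :=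
    fun idx => lt_of_le_of_lt (List.countP_le_length) (lt_of_le_of_lt (ordPairs_length_le _) (by norm_num))
  rw [field_extract 9 _ hb (56 * 3364) (3364 * ρ + (58 * p + q)) (by omega)]
  show countPair ((3364 * ρ + (58 * p + q)) % 3364 / 58) ((3364 * ρ + (58 * p + q)) % 58) (ordPairs ((3364 * ρ + (58 * p + q)) / 3364)) = _
  rw [show (3364 * ρ + (58 * p + q)) % 3364 / 58 = p by omega, show (3364 * ρ + (58 * p + q)) % 58 = q by omega,
    show (3364 * ρ + (58 * p + q)) / 3364 = ρ by omega]

end Summit.HubbardSuperconductivity.HubbardSuperconductivity.Theorems.AnisotropyChord.FourTorus
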